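import Literature.AnabelianGeometry.AbsoluteAnabelian.MLFGaloisCategories
import Mathlib.CategoryTheory.Widesubcategory
import Mathlib.CategoryTheory.Core

/-!
# The subcategories `𝒞̲^MLF_T` (T-isomorphisms), `𝒞^MLF_T` (Galois-isomorphisms), the isomorphism
# subcategory, and `𝒞^{MLF⊢}_T` (mono-analytic type) of [AbsTopIII] Definition 3.1 (iii)

S. Mochizuki, *Topics in absolute anabelian geometry III*, §3, Def. 3.1 (iii) p. 67–68 (bib key
`MochizukiAbsTopIII2015`; locators = kurims manuscript pages, lit key `paper:url-5493eb38cbb7`): "Also, we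
shall use the same notation, except with `𝒞` replaced by `𝒞̲` (respectively, `𝒞` [second underline
style]; `𝒞` [double underline]) to denote the various subcategories determined by the `T`-isomorphisms
(respectively, Galois-isomorphisms; isomorphisms); we shall use the same notation, with `MLF` replaced
by `MLF-hyp` (respectively, `MLF-sB`; `MLF⊢`) to denote the various full subcategories determined by the
objects of hyperbolic orbicurve type (respectively, of strictly Belyi type; of mono-analytic type)."

`MLFGaloisCategories.lean` (seat abc-iut-L4-t2) typed `𝒞^MLF_T` and left these subcategories out
("Deliberately NOT here: … the subcategories of `T`-isomorphisms and Galois-isomorphisms").  This file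
(seat abc-iut-L4-t2) supplies them on ABSTRACT pairs, as honest Mathlib (wide / full) subcategories:

* `GaloisMonoidPair.tIso`, `.galoisIso` / `GaloisFieldPair.tIso`, `.galoisIso` — the morphism
  properties "`φ_M` is an isomorphism" / "`φ_Π` is an isomorphism [of topological groups]" (Def. 3.1 (ii),
  `Hom.IsTIso` / `Hom.IsGaloisIso` of `MLFGaloisPairs.lean`), PROVED multiplicative (identities,
  composition);
* `MLFGaloisMonoidPairTIsoCat T`, `MLFGaloisMonoidPairGaloisIsoCat T`, `MLFGaloisFieldPairTIsoCat`,
  `MLFGaloisFieldPairGaloisIsoCat` — the WIDE subcategories `𝒞̲^MLF_T`, `𝒞^MLF_T` of `𝒞^MLF_T`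
  (Mathlib `WideSubcategory` of the morphism property pulled back along the inclusion);
  `MLFGaloisMonoidPairIsoCat T`, `MLFGaloisFieldPairIsoCat` — the double-underlined `𝒞^MLF_T`
  (isomorphisms) as Mathlib's `Core`;
* `MLFGaloisMonoAnalyticMonoidPairCat T`, `MLFGaloisMonoAnalyticFieldPairCat` — the FULL subcategories
  `𝒞^{MLF⊢}_T` of pairs of mono-analytic type (`IsOfMonoAnalyticTypeMonoid/Field`), with their inclusions.

Deliberately NOT here: `𝒞^{MLF-hyp}_T`, `𝒞^{MLF-sB}_T` — "of hyperbolic orbicurve / strictly Belyi type" is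
scheme-theoretic (the surjection `Π_k ↠ G_k` "arises from the étale fundamental group of a hyperbolic
orbicurve"); in the tree it is a PARAMETER predicate (`MonoidKummerMaps.lean`, `MonoidKummerMapsSub.lean`:
`MLFGaloisMonoidPairSubcat H`), owner of the model interface: seat abc-iut-L4-t1.
HONEST FRAMING: bookkeeping over OUR kernel definitions; nothing here bears on [IUTchIII] Cor. 3.12.
-/

noncomputable section

universe u

namespace Literature.AnabelianGeometry.AbsoluteAnabelian

open _root_.CategoryTheory

/-! ### The morphism properties "`T`-isomorphism" and "Galois-isomorphism" -/

namespace GaloisMonoidPair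

/-- **`T`-isomorphisms** (Def 3.1 (ii): "`φ_M` … is an isomorphism") as a morphism property on the
category of pairs of `TCG/TLG/TM`-shape. [cite: MochizukiAbsTopIII2015, Definition 3.1 (ii) p.67] -/
def tIso : MorphismProperty GaloisMonoidPair.{u} := fun _ _ φ => GaloisMonoidPair.Hom.IsTIso φ

/-- **Galois-isomorphisms** (Def 3.1 (ii): "`φ_Π` … is an isomorphism" of topological groups: bijective
and open). [cite: MochizukiAbsTopIII2015, Definition 3.1 (ii) p.67] -/
def galoisIso : MorphismProperty GaloisMonoidPair.{u} := fun _ _ φ => GaloisMonoidPair.Hom.IsGaloisIso φ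

/-- `φ` is a `T`-isomorphism iff `φ_M` is bijective (unfolding). [cite: MochizukiAbsTopIII2015, Definition 3.1 (ii) p.67] -/
theorem tIso_iff {P Q : GaloisMonoidPair.{u}} (φ : P ⟶ Q) :
    tIso φ ↔ Function.Bijective (GaloisMonoidPair.Hom.homM φ) := Iff.rfl

/-- `φ` is a Galois-isomorphism iff `φ_Π` is bijective and open (unfolding).
[cite: MochizukiAbsTopIII2015, Definition 3.1 (ii) p.67] -/
theorem galoisIso_iff {P Q : GaloisMonoidPair.{u}} (φ : P ⟶ Q) :
    galoisIso φ ↔ Function.Bijective (GaloisMonoidPair.Hom.homPi φ) ∧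
      IsOpenMap (GaloisMonoidPair.Hom.homPi φ) := Iff.rfl

/-- `T`-isomorphisms contain the identities and are stable under composition.
[cite: MochizukiAbsTopIII2015, Definition 3.1 (iii) p.67] -/
instance tIso_isMultiplicative : (tIso.{u}).IsMultiplicative where
  id_mem _ := Function.bijective_id
  comp_mem φ ψ hφ hψ := by
    change Function.Bijective fun x => GaloisMonoidPair.Hom.homM ψ (GaloisMonoidPair.Hom.homM φ x)
    exact Function.Bijective.comp hψ hφ

/-- Galois-isomorphisms contain the identities and are stable under composition.
[cite: MochizukiAbsTopIII2015, Definition 3.1 (iii) p.67] -/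
instance galoisIso_isMultiplicative : (galoisIso.{u}).IsMultiplicative where
  id_mem _ := ⟨Function.bijective_id, IsOpenMap.id⟩
  comp_mem φ ψ hφ hψ := by
    change Function.Bijective (fun g => GaloisMonoidPair.Hom.homPi ψ (GaloisMonoidPair.Hom.homPi φ g)) ∧
      IsOpenMap (fun g => GaloisMonoidPair.Hom.homPi ψ (GaloisMonoidPair.Hom.homPi φ g))
    exact ⟨Function.Bijective.comp hψ.1 hφ.1, IsOpenMap.comp hψ.2 hφ.2⟩

end GaloisMonoidPair

namespace GaloisFieldPair

/-- **`T`-isomorphisms** of `TF`-pairs as a morphism property. [cite: MochizukiAbsTopIII2015, Definition 3.1 (ii) p.67] -/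
def tIso : MorphismProperty GaloisFieldPair.{u} := fun _ _ φ => GaloisFieldPair.Hom.IsTIso φ

/-- **Galois-isomorphisms** of `TF`-pairs as a morphism property. [cite: MochizukiAbsTopIII2015, Definition 3.1 (ii) p.67] -/
def galoisIso : MorphismProperty GaloisFieldPair.{u} := fun _ _ φ => GaloisFieldPair.Hom.IsGaloisIso φ

/-- `φ` is a `T`-isomorphism iff `φ_M` is bijective (unfolding). [cite: MochizukiAbsTopIII2015, Definition 3.1 (ii) p.67] -/
theorem tIso_iff {P Q : GaloisFieldPair.{u}} (φ : P ⟶ Q) :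
    tIso φ ↔ Function.Bijective (GaloisFieldPair.Hom.homM φ) := Iff.rfl

/-- `φ` is a Galois-isomorphism iff `φ_Π` is bijective and open (unfolding).
[cite: MochizukiAbsTopIII2015, Definition 3.1 (ii) p.67] -/
theorem galoisIso_iff {P Q : GaloisFieldPair.{u}} (φ : P ⟶ Q) :
    galoisIso φ ↔ Function.Bijective (GaloisFieldPair.Hom.homPi φ) ∧
      IsOpenMap (GaloisFieldPair.Hom.homPi φ) := Iff.rfl

/-- `T`-isomorphisms of `TF`-pairs are multiplicative. [cite: MochizukiAbsTopIII2015, Definition 3.1 (iii) p.67] -/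
instance tIso_isMultiplicative : (tIso.{u}).IsMultiplicative where
  id_mem _ := Function.bijective_id
  comp_mem φ ψ hφ hψ := by
    change Function.Bijective fun x => GaloisFieldPair.Hom.homM ψ (GaloisFieldPair.Hom.homM φ x)
    exact Function.Bijective.comp hψ hφ

/-- Galois-isomorphisms of `TF`-pairs are multiplicative. [cite: MochizukiAbsTopIII2015, Definition 3.1 (iii) p.67] -/
instance galoisIso_isMultiplicative : (galoisIso.{u}).IsMultiplicative where
  id_mem _ := ⟨Function.bijective_id, IsOpenMap.id⟩
  comp_mem φ ψ hφ hψ := by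
    change Function.Bijective (fun g => GaloisFieldPair.Hom.homPi ψ (GaloisFieldPair.Hom.homPi φ g)) ∧
      IsOpenMap (fun g => GaloisFieldPair.Hom.homPi ψ (GaloisFieldPair.Hom.homPi φ g))
    exact ⟨Function.Bijective.comp hψ.1 hφ.1, IsOpenMap.comp hψ.2 hφ.2⟩

end GaloisFieldPair

/-! ### The inclusions `𝒞^MLF_T ⥤` (all pairs) -/

/-- The (fully faithful) inclusion of `𝒞^MLF_T` into all pairs, `T ∈ {TCG, TLG, TM}`.
[cite: MochizukiAbsTopIII2015, Definition 3.1 (iii) p.67] -/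
def MLFGaloisMonoidPairCat.ι (T : PairType) : MLFGaloisMonoidPairCat.{u} T ⥤ GaloisMonoidPair.{u} :=
  ObjectProperty.ι _

/-- The (fully faithful) inclusion of `𝒞^MLF_TF` into all `TF`-pairs.
[cite: MochizukiAbsTopIII2015, Definition 3.1 (iii) p.67] -/
def MLFGaloisFieldPairCat.ι : MLFGaloisFieldPairCat.{u} ⥤ GaloisFieldPair.{u} :=
  ObjectProperty.ι _

/-! ### `𝒞̲^MLF_T` (T-isomorphisms), `𝒞^MLF_T` (Galois-isomorphisms), isomorphisms -/

/-- **`𝒞̲^MLF_T`**: the wide subcategory of `𝒞^MLF_T` "determined by the `T`-isomorphisms",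
`T ∈ {TCG, TLG, TM}`. [cite: MochizukiAbsTopIII2015, Definition 3.1 (iii) p.67] -/
abbrev MLFGaloisMonoidPairTIsoCat (T : PairType) : Type (u + 1) :=
  WideSubcategory (GaloisMonoidPair.tIso.{u}.inverseImage (MLFGaloisMonoidPairCat.ι T))

/-- **`𝒞^MLF_T` [Galois-isomorphism subcategory]**: the wide subcategory of `𝒞^MLF_T` "determined by the
Galois-isomorphisms" — the version used by Cor 3.6 / Cor 3.7 ("the evident restrictions" of `log`,
`λ^×`, `λ^{×pf}`). [cite: MochizukiAbsTopIII2015, Definition 3.1 (iii) p.67] -/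
abbrev MLFGaloisMonoidPairGaloisIsoCat (T : PairType) : Type (u + 1) :=
  WideSubcategory (GaloisMonoidPair.galoisIso.{u}.inverseImage (MLFGaloisMonoidPairCat.ι T))

/-- **`𝒞^MLF_T` [double-underlined]**: the subcategory "determined by the isomorphisms" — Mathlib's
`Core` (the maximal sub-groupoid) of `𝒞^MLF_T`. [cite: MochizukiAbsTopIII2015, Definition 3.1 (iii) p.67] -/
abbrev MLFGaloisMonoidPairIsoCat (T : PairType) : Type (u + 1) := Core (MLFGaloisMonoidPairCat.{u} T)

/-- **`𝒞̲^MLF_TF`**: `T`-isomorphisms of MLF-Galois `TF`-pairs (wide subcategory).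
[cite: MochizukiAbsTopIII2015, Definition 3.1 (iii) p.67] -/
abbrev MLFGaloisFieldPairTIsoCat : Type (u + 1) :=
  WideSubcategory (GaloisFieldPair.tIso.{u}.inverseImage MLFGaloisFieldPairCat.ι)

/-- **`𝒞^MLF_TF` [Galois-isomorphism subcategory]** (wide subcategory).
[cite: MochizukiAbsTopIII2015, Definition 3.1 (iii) p.67] -/
abbrev MLFGaloisFieldPairGaloisIsoCat : Type (u + 1) :=
  WideSubcategory (GaloisFieldPair.galoisIso.{u}.inverseImage MLFGaloisFieldPairCat.ι)

/-- **`𝒞^MLF_TF` [double-underlined]**: isomorphisms of MLF-Galois `TF`-pairs (`Core`).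
[cite: MochizukiAbsTopIII2015, Definition 3.1 (iii) p.67] -/
abbrev MLFGaloisFieldPairIsoCat : Type (u + 1) := Core MLFGaloisFieldPairCat.{u}

/-- The forgetful functor `𝒞̲^MLF_T ⥤ 𝒞^MLF_T`. [cite: MochizukiAbsTopIII2015, Definition 3.1 (iii) p.67] -/
def MLFGaloisMonoidPairTIsoCat.ι (T : PairType) : MLFGaloisMonoidPairTIsoCat.{u} T ⥤ MLFGaloisMonoidPairCat.{u} T :=
  wideSubcategoryInclusion _

/-- The forgetful functor `𝒞^MLF_T [Galois-isos] ⥤ 𝒞^MLF_T`. [cite: MochizukiAbsTopIII2015, Definition 3.1 (iii) p.67] -/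
def MLFGaloisMonoidPairGaloisIsoCat.ι (T : PairType) :
    MLFGaloisMonoidPairGaloisIsoCat.{u} T ⥤ MLFGaloisMonoidPairCat.{u} T :=
  wideSubcategoryInclusion _

/-- The forgetful functor `𝒞̲^MLF_TF ⥤ 𝒞^MLF_TF`. [cite: MochizukiAbsTopIII2015, Definition 3.1 (iii) p.67] -/
def MLFGaloisFieldPairTIsoCat.ι : MLFGaloisFieldPairTIsoCat.{u} ⥤ MLFGaloisFieldPairCat.{u} :=
  wideSubcategoryInclusion _

/-- The forgetful functor `𝒞^MLF_TF [Galois-isos] ⥤ 𝒞^MLF_TF`. [cite: MochizukiAbsTopIII2015, Definition 3.1 (iii) p.67] -/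
def MLFGaloisFieldPairGaloisIsoCat.ι : MLFGaloisFieldPairGaloisIsoCat.{u} ⥤ MLFGaloisFieldPairCat.{u} :=
  wideSubcategoryInclusion _

/-- A morphism of `𝒞̲^MLF_T` IS a `T`-isomorphism: its `φ_M` is bijective.
[cite: MochizukiAbsTopIII2015, Definition 3.1 (iii) p.67] -/
theorem MLFGaloisMonoidPairTIsoCat.bijective_homM {T : PairType} {P Q : MLFGaloisMonoidPairTIsoCat.{u} T}
    (φ : P ⟶ Q) : Function.Bijective (GaloisMonoidPair.Hom.homM (P := P.obj.obj) (Q := Q.obj.obj) φ.hom.hom) :=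
  φ.property

/-- A morphism of the Galois-isomorphism subcategory IS a Galois-isomorphism: its `φ_Π` is bijective and
open. [cite: MochizukiAbsTopIII2015, Definition 3.1 (iii) p.67] -/
theorem MLFGaloisMonoidPairGaloisIsoCat.bijective_homPi {T : PairType}
    {P Q : MLFGaloisMonoidPairGaloisIsoCat.{u} T} (φ : P ⟶ Q) :
    Function.Bijective (GaloisMonoidPair.Hom.homPi (P := P.obj.obj) (Q := Q.obj.obj) φ.hom.hom) ∧
      IsOpenMap (GaloisMonoidPair.Hom.homPi (P := P.obj.obj) (Q := Q.obj.obj) φ.hom.hom) :=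
  φ.property

/-! ### `𝒞^{MLF⊢}_T`: the full subcategories of pairs of mono-analytic type -/

/-- **`𝒞^{MLF⊢}_T`**, `T ∈ {TCG, TLG, TM}`: the full subcategory of `𝒞^MLF_T` "determined by the objects of
mono-analytic type" (`ε_k` an isomorphism, Def 3.1 (ii)); the object property is stated as the
conjunction with `IsMLFGaloisMonoidPair` so that the inclusion into `𝒞^MLF_T` is literal.
[cite: MochizukiAbsTopIII2015, Definition 3.1 (iii) p.68] -/
def MLFGaloisMonoAnalyticMonoidPairCat (T : PairType) : Type (u + 1) :=
  ObjectProperty.FullSubcategory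
    (fun P : GaloisMonoidPair.{u} => IsMLFGaloisMonoidPair T P ∧ IsOfMonoAnalyticTypeMonoid T P)

/-- The category structure on `𝒞^{MLF⊢}_T`. [cite: MochizukiAbsTopIII2015, Definition 3.1 (iii) p.68] -/
instance (T : PairType) : Category (MLFGaloisMonoAnalyticMonoidPairCat.{u} T) :=
  inferInstanceAs (Category (ObjectProperty.FullSubcategory _))

/-- **`𝒞^{MLF⊢}_TF`**: the full subcategory of MLF-Galois `TF`-pairs of mono-analytic type.
[cite: MochizukiAbsTopIII2015, Definition 3.1 (iii) p.68] -/
def MLFGaloisMonoAnalyticFieldPairCat : Type (u + 1) :=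
  ObjectProperty.FullSubcategory
    (fun P : GaloisFieldPair.{u} => IsMLFGaloisFieldPair P ∧ IsOfMonoAnalyticTypeField P)

/-- The category structure on `𝒞^{MLF⊢}_TF`. [cite: MochizukiAbsTopIII2015, Definition 3.1 (iii) p.68] -/
instance : Category MLFGaloisMonoAnalyticFieldPairCat.{u} :=
  inferInstanceAs (Category (ObjectProperty.FullSubcategory _))

/-- The inclusion `𝒞^{MLF⊢}_T ⥤ 𝒞^MLF_T`. [cite: MochizukiAbsTopIII2015, Definition 3.1 (iii) p.68] -/
def MLFGaloisMonoAnalyticMonoidPairCat.ι (T : PairType) :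
    MLFGaloisMonoAnalyticMonoidPairCat.{u} T ⥤ MLFGaloisMonoidPairCat.{u} T where
  obj P := ⟨P.obj, P.property.1⟩
  map φ := InducedCategory.homMk φ.hom

/-- The inclusion `𝒞^{MLF⊢}_TF ⥤ 𝒞^MLF_TF`. [cite: MochizukiAbsTopIII2015, Definition 3.1 (iii) p.68] -/
def MLFGaloisMonoAnalyticFieldPairCat.ι : MLFGaloisMonoAnalyticFieldPairCat.{u} ⥤ MLFGaloisFieldPairCat.{u} where
  obj P := ⟨P.obj, P.property.1⟩
  map φ := InducedCategory.homMk φ.hom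

end Literature.AnabelianGeometry.AbsoluteAnabelian

end
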